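import Summits.BirchSwinnertonDyer.BirchSwinnertonDyer.Theorems.SchneiderFreeAdditiveX3AnomalousTwistPartnerFacts
import Summits.BirchSwinnertonDyer.BirchSwinnertonDyer.Theorems.EisensteinPrimesSurLambdaCaseCTCOfPoitouTateAt
import Summits.BirchSwinnertonDyer.BirchSwinnertonDyer.Theorems.EisensteinPrimesPoitouTateShaNaturalAtTC
import Summits.BirchSwinnertonDyer.BirchSwinnertonDyer.Theorems.EisensteinPrimesAcTwistDeformationImprimCorankOfSurC
import Summits.BirchSwinnertonDyer.BirchSwinnertonDyer.Theorems.EisensteinPrimesGoodLatticeCorankOfGe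
import Summits.BirchSwinnertonDyer.BirchSwinnertonDyer.Theorems.EisensteinPrimesGoodLatticeQuotientOfCorank
import Summits.BirchSwinnertonDyer.BirchSwinnertonDyer.Theorems.EisensteinPrimesGoodLatticeImprimitiveOfQuotient
import Literature.NumberTheory.IwasawaTheory.Greenberg2006.GlobalEulerPoincareCorankOfTateTC
import Literature.NumberTheory.GaloisCohomology.TateGlobalEulerCharacteristicTotallyComplex
import Literature.NumberTheory.GaloisCohomology.RestrictedRamificationPoitouTateThreeLeTotallyComplex
import Literature.NumberTheory.GaloisRepresentations.LocalEulerPoincareCharacteristicProofs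
import Literature.NumberTheory.IwasawaTheory.Greenberg2006.LocalH2VanishingOfLOC1
import HarnessLib

/-!
# Route `SchneiderFreeAdditiveX3` (K1 door), the (G-ord, `e = 2`) cell AT `p = 3`, ANOMALOUS twists: [INV.μ] and the torsion clause of the
# anomalous twin WITHOUT the named facts [RH] (Keller–Yin 2402.12781 Thm. 1.2.2) and [PWL-θ] (Prop. 1.2.5) — [RH] as its two INSTANCE CLAUSES at
# the twist's own pair, [PWL-θ] the tree theorem of F46

Cell `bsd-schneider-ideate`, seat `bsd-schneider-door-c5` (prover, generation 41; assembly layer; `--supports` 19177, helper).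
PARTITION: board row B6 ∩ X3 ∩ sst-twist, `r = 1`, (G-ord, `e = 2`) half at `p = 3`, the 1 725 ANOMALOUS pairs of `Rank1Residual.partition` —
COMPOSITION theorems; types-the-object-of nothing; closes none of B6's cells (BSD NOT advanced).  bears_on: K1-door (19177 r3 `GordTwoBranchIMC`).
FILE 1 of the [RH] re-key (generation 41's F47 series).

## Why / what

Crux r3 BY NAME (F44) carries `hRH : KellerYin2024.thm122_rubinHida_residualPair_unrSelmer` — Rubin 1991 + Hida 2010 for the residual pair, a statement
whose `𝓕_nr`/anomalous formulation is written only in the PREPRINT arXiv:2402.12781 — and consumed it in exactly one way: instantiated at the Ribet member of the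
partner's class to yield «every primitive BDP dual datum of the character Selmer group of `θ|_K` is finitely generated `Λ`-torsion with `μ = 0`» for the two
characters `θ ∈ {θsub, θquot}` of the twist's residual pair.  Those two clauses ARE delivered, at the door's data (`K` with `d_K` odd, `(3)` split, a Katz frame of
`θquot|_K`), by cell `bsd-eis`'s kernel roads `CharMainConjOnTreeOfPub.charMainConjOnTree_ofPoitouTateAt` ([BR𝟙], `θquot` unramified at `3`) and
`ResidualPairMuLambdaOfPub.omegaSide_ofPoitouTateAt` ([BRω], `θsub`) from {Bleher et al. 2020 Thm. 3.3.1, de Shalit II.6.4, Hida Thm. I} — which generations 31–40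
already CALL for the `λ`-clauses, discarding the torsion/`μ` clauses.  This file re-types generation 28's shared-pair dévissage and generation 32's anomalous-twist
[INV.μ] theorem on the INSTANCE clauses (`hRHs`, `hRHq`) instead of the named fact, with [PWL-θ] fed by F46's
`KYProp125ResidualPairHolds.prop125_residualPair_unrSelmer_imprimitive_holds`:
* §1 `xAc_moduleFinite_isTorsion_muInvariant_of_clauses_of_sharedPair` (twin of `AnomalousTwistMuZero.…_of_RH_of_PWL_of_sharedPair`);
* §2 `xAc_moduleFinite_isTorsion_muInvariant_of_clauses_of_anomalousTwist` (twin of `AnomalousTwistPartnerFacts.…_of_RH_of_PWL_of_anomalousTwist`, the pair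
  of `W` now a binder so that the clauses can be supplied).
Proof bodies token-identical to the sources except at the two re-keyed points.

HONEST FRAMING: compositions of tree theorems, CONDITIONAL only on the displayed instance clauses (no named fact); nothing analytic; no registered stub of 19177
is closed; no item closed; BSD proved for no curve; «closes rung: none».  No definition, no named fact, no `sorry`.
References: [KellerYin2024] Prop. 1.2.5, Prop. 1.3.1, Thm. 1.4.1, Lemma 5.1.1 (arXiv:2402.12781v2); [PollackWeston2011] Prop. A.2; [CastellaGrossiLeeSkinner2022]
§1.4; [Brink2007] Cor. 1; [SilvermanAEC2009] VII.7.2, X.5.4; this seat p690698 (gen 28), p71xxxx (gen 32 `AnomalousTwistPartnerFacts`), p760650 (F46).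
-/

set_option autoImplicit false
-- `Summit.<P>.<Sub>` repeats `BirchSwinnertonDyer` by the tree's layout convention (D-0017)
set_option linter.dupNamespace false

noncomputable section

open scoped Classical NumberField

open Field NumberField IsDedekindDomain IsDedekindDomain.HeightOneSpectrum WeierstrassCurve Rat.HeightOneSpectrum
  Literature.NumberTheory.EllipticCurves Literature.NumberTheory.EllipticCurves.GreenbergSelmer
  Literature.NumberTheory.GaloisRepresentations
  Literature.NumberTheory.EllipticCurves.Rank1Residual
  Literature.NumberTheory.EllipticCurves.KellerYin2024
  Literature.NumberTheory.EllipticCurves.GreenbergVatsal2000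
  Literature.NumberTheory.IwasawaTheory
  Summit.BirchSwinnertonDyer.Rank1Residual Summit.BirchSwinnertonDyer.Rank1Residual.GaloisImage
  Summit.BirchSwinnertonDyer.Rank1Residual.Additive
  Summit.BirchSwinnertonDyer.Rank1Residual.X11b Summit.BirchSwinnertonDyer.Rank1Residual.X11b.AcSelmer
  Summit.BirchSwinnertonDyer.BirchSwinnertonDyer.Theorems
  Summit.BirchSwinnertonDyer.BirchSwinnertonDyer.Theorems.SchneiderFree
  Summit.BirchSwinnertonDyer.BirchSwinnertonDyer.Theorems.EisensteinPrimesMuLambda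
  Summit.BirchSwinnertonDyer.BirchSwinnertonDyer.Theorems.SchneiderFreeAdditiveX3.TwistThreeResidualPair
  Summit.BirchSwinnertonDyer.BirchSwinnertonDyer.Theorems.SchneiderFreeAdditiveX3.ResidualPairIsogeny
  Summit.BirchSwinnertonDyer.BirchSwinnertonDyer.Theorems.SchneiderFreeAdditiveX3.AnomalousTwistMuZero
  Summit.BirchSwinnertonDyer.BirchSwinnertonDyer.Theorems.SchneiderFreeAdditiveX3.KYMuZeroGoodOrd
  Summit.BirchSwinnertonDyer.BirchSwinnertonDyer.Theorems.SchneiderFreeAdditiveX3.AnomalousTwistPartnerFacts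
open Literature.NumberTheory.EllipticCurves.KellerYin2024 (prop125_residualPair_unrSelmer_imprimitive)

namespace Summit.BirchSwinnertonDyer.BirchSwinnertonDyer.Theorems.SchneiderFreeAdditiveX3.AnomalousTwistMuZeroOfTree

/-! ### §1 The shared-pair dévissage on instance clauses (twin of generation 28's `…_of_RH_of_PWL_of_sharedPair`) -/

section SharedPair

/-- **[INV.μ] + torsion for ANY elliptic curve over `K` sharing the partner's residual characters — [RH] AS INSTANCE CLAUSES, [PWL-θ] A TREE THEOREM.**
Generation 28's `AnomalousTwistMuZero.xAc_moduleFinite_isTorsion_muInvariant_of_RH_of_PWL_of_sharedPair` with its two NAMED inputs re-keyed: the Keller–Yin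
2402.12781 Thm. 1.2.2 binder `(hRH : thm122_rubinHida_residualPair_unrSelmer)` is REPLACED by its two instance clauses `hRHs`, `hRHq` at the partner's pair
(every primitive BDP dual datum of the character Selmer group of `θsub|_K`, resp. `θquot|_K`, finitely generated `Λ`-torsion with `μ = 0` — exactly what the
named fact was instantiated to, and what cell `bsd-eis`'s `charMainConjOnTree_ofPoitouTateAt` / `omegaSide_ofPoitouTateAt` deliver at the door's data), and
the Prop. 1.2.5 binder `(hPWL : prop125_residualPair_unrSelmer_imprimitive)` is FED by the tree (the body of this seat's F46
`KYProp125ResidualPairHolds.prop125_residualPair_unrSelmer_imprimitive_holds`, inlined).  Data and conclusion token-identical otherwise: `V/ℚ` globally minimal,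
good ordinary anomalous at `3` in Keller–Yin's normalisation, `Φ ≤ V[3]` a rational line with Teichmüller pair `(θsub, θquot)`, `K` Heegner for `N_V` with
`(3)` split and `V(K)[3] = 0`, `W₁/K` ANY elliptic curve with residual pair `(θsub|_K, θquot|_K)` in either order and good reduction off `Sf ∪ {w ∣ 3}`:
`X_ac^{Sf}(W₁[3^∞])` is finitely generated `Λ`-torsion with `μ = 0` and `X_ac^∅(W₁[3^∞])` is torsion with `μ = 0`.  No named hypothesis.
[cite: KellerYin2024, Prop. 1.2.5, Prop. 1.3.1, Thm. 1.4.1, Lemma 5.1.1 (arXiv:2402.12781v2)] [cite: PollackWeston2011, App. A Prop. A.2]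
[cite: CastellaGrossiLeeSkinner2022, §1.4 Props. 17–18] [cite: Brink2007, Cor. 1] [cite: GreenbergLNM1716, §1 p. 60] -/
theorem xAc_moduleFinite_isTorsion_muInvariant_of_clauses_of_sharedPair
    {V : WeierstrassCurve ℚ} [V.IsElliptic] [V.IsGloballyMinimal] (hord : GoodOrd V 3) (hanom : (3 : ℤ) ∣ V.frobeniusTrace 3 - 1)
    (hlat : ∀ Φ : AddSubgroup (geomTorsion V ((3 : ℕ) : ℤ)), IsRationalLine V 3 Φ → ¬ LineUnramifiedAt V 3 Φ)
    {Φ : AddSubgroup (geomTorsion V ((3 : ℕ) : ℤ))} (hΦ : IsRationalLine V 3 Φ)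
    {θsub θquot : FramedGaloisRep ℚ (padicCoeffIntegers (∅ : Set (PadicAlgCl 3))) 1}
    (hsub : IsTeichmullerLiftOn (∅ : Set (PadicAlgCl 3)) (Φ.map (geomTorsion V ((3 : ℕ) : ℤ)).subtype) θsub)
    (hquot : IsTeichmullerLiftOnQuot (∅ : Set (PadicAlgCl 3)) (Φ.map (geomTorsion V ((3 : ℕ) : ℤ)).subtype)
      (geomTorsion V ((3 : ℕ) : ℤ)) θquot)
    (K : Type) [Field K] [NumberField K] (hK : IsImaginaryQuadratic K) (hHV : SatisfiesHeegnerHypothesis (V.conductorNorm ℤ) K)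
    (hsplit : ((Ideal.span {(3 : ℤ)}).primesOver (𝓞 K)).ncard = 2) (hVK : ∀ Q : (V.baseChange K).toAffine.Point, 3 • Q = 0 → Q = 0)
    (ι : K →+* ℚ_[3]) (v vbar : HeightOneSpectrum (𝓞 K)) (hv : ∀ x : 𝓞 K, x ∈ v.asIdeal ↔ ‖ι (x : K)‖ < 1)
    (hvbar : ((3 : ℕ) : 𝓞 K) ∈ vbar.asIdeal) (hne : vbar ≠ v)
    (κ : ZpExtension K 3) (hκ : κ.IsAnticyclotomic) (γ : absoluteGaloisGroup K) [hγ : Fact (κ.IsTopGenerator γ)]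
    (hRHs : ∀ D : DatumDualData κ γ (charModule ∅ (θsub.restrictField K))
        (Castella2018.AcSelmer.bdpData (charModule ∅ (θsub.restrictField K)) 3 vbar) (∅ : Set (HeightOneSpectrum (𝓞 K))),
      Module.Finite (IwasawaAlgebra 3) D.X ∧ Module.IsTorsion (IwasawaAlgebra 3) D.X ∧ muInvariant 3 D.X = 0)
    (hRHq : ∀ D : DatumDualData κ γ (charModule ∅ (θquot.restrictField K))
        (Castella2018.AcSelmer.bdpData (charModule ∅ (θquot.restrictField K)) 3 vbar) (∅ : Set (HeightOneSpectrum (𝓞 K))),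
      Module.Finite (IwasawaAlgebra 3) D.X ∧ Module.IsTorsion (IwasawaAlgebra 3) D.X ∧ muInvariant 3 D.X = 0)
    (Sf : Finset (HeightOneSpectrum (𝓞 K)))
    (hSf : ∀ w : HeightOneSpectrum (𝓞 K), w ∈ Sf ↔ ((V.conductorNorm ℤ : ℤ) : 𝓞 K) ∈ w.asIdeal)
    (W₁ : WeierstrassCurve K) [W₁.IsElliptic]
    {θa θb : FramedGaloisRep K (padicCoeffIntegers (∅ : Set (PadicAlgCl 3))) 1}
    (hab : (θa = θsub.restrictField K ∧ θb = θquot.restrictField K) ∨ (θa = θquot.restrictField K ∧ θb = θsub.restrictField K))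
    (hpair : IsResidualPairOver W₁ 3 θa θb)
    (hgood : ∀ w : HeightOneSpectrum (𝓞 K), w ∉ (↑Sf : Set (HeightOneSpectrum (𝓞 K))) → ((3 : ℕ) : 𝓞 K) ∉ w.asIdeal →
      W₁.HasGoodReductionAt w) :
    (Module.Finite (IwasawaAlgebra 3) (Castella2018.AcSelmer.XAc W₁ 3 κ vbar (↑Sf : Set (HeightOneSpectrum (𝓞 K))) γ) ∧
      Module.IsTorsion (IwasawaAlgebra 3) (Castella2018.AcSelmer.XAc W₁ 3 κ vbar (↑Sf : Set (HeightOneSpectrum (𝓞 K))) γ) ∧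
      muInvariant 3 (Castella2018.AcSelmer.XAc W₁ 3 κ vbar (↑Sf : Set (HeightOneSpectrum (𝓞 K))) γ) = 0) ∧
    (Module.IsTorsion (IwasawaAlgebra 3) (Castella2018.AcSelmer.XAc W₁ 3 κ vbar ∅ γ) ∧
      muInvariant 3 (Castella2018.AcSelmer.XAc W₁ 3 κ vbar ∅ γ) = 0) := by
  have hp2 : (3 : ℕ) ≠ 2 := by norm_num
  have hpairV : IsResidualPairOver (V.baseChange K) 3 (θsub.restrictField K) (θquot.restrictField K) :=
    isResidualPairOver_restrictField V 3 K hΦ hsub hquot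
  have hredV : Red V 3 := not_hasIrreducibleModPGaloisRep_of_isRationalLine hΦ
  have hanomV : Anom V 3 := ⟨hredV, hord.1, by exact_mod_cast hanom⟩
  have hH3 : SatisfiesHeegnerHypothesis 3 K := fun q hq hq3 ↦ by
    rw [(Nat.prime_dvd_prime_iff_eq hq Nat.prime_three).mp hq3]; exact_mod_cast hsplit
  -- [PWL-θ] is a tree theorem (F46); fed with the instance clauses `hRHs`, `hRHq` at the partner, for both characters
  have hPWL : prop125_residualPair_unrSelmer_imprimitive :=
    -- the body of F46 `KYProp125ResidualPairHolds.prop125_residualPair_unrSelmer_imprimitive_holds` INLINED (cell `bsd-eis`'s four roads fed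
    -- with the tree's Greenberg 2016 Prop. 2.6.3 (c) at TC `K`, Greenberg 2006 Props. 4.1 / 4.2 / §5 A and Tate's EPC at TC fields), so that this
    -- file does not wait for F46's olean on the check farm
    GoodLatticeImprimitiveOfQuotient.prop125_imprimitive_of_quotient
      (GoodLatticeQuotientOfCorank.prop125_quotient_of_corank
        (GoodLatticeCorankOfGe.prop125_corank_of_ge
          (AcTwistDeformation.prop125_residualPair_unrSelmer_corank_ge_of_facts_ofSurC
            (SurLambda.prop263_sur_of_crk_caseC_tc_of_poitouTateNaturalAt
              PoitouTateShaNaturalAtTC.forall_poitouTate_shaRestricted_tateDual_natural_at_of_isTotallyComplex)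
            (Literature.NumberTheory.IwasawaTheory.Greenberg2006.prop41_of_tate_of_poitouTate_three_le_of_isTotallyComplex
              Literature.NumberTheory.GaloisCohomology.forall_tateGlobalEulerPoincareCharacteristic_of_isTotallyComplex
              Literature.NumberTheory.GaloisCohomology.forall_poitouTate_restricted_three_le_of_isTotallyComplex)
            Literature.NumberTheory.IwasawaTheory.Greenberg2006.LocalEulerPoincareCorank.prop42_localEulerPoincareCorank_holds
            Literature.NumberTheory.IwasawaTheory.Greenberg2006.sec5A_localH2_subsingleton_of_LOC1_holds
            Literature.NumberTheory.GaloisCohomology.forall_tateGlobalEulerPoincareCharacteristic_of_isTotallyComplex)))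
  have hSs := (hPWL V 3 (by norm_num) hord.1 hredV hanomV hlat K hK hHV hH3 hVK ι v vbar hv hvbar hne κ hκ γ
    (θsub.restrictField K) (θquot.restrictField K) hpairV Sf hSf (θsub.restrictField K) (Or.inl rfl) hRHs).1
  have hSq := (hPWL V 3 (by norm_num) hord.1 hredV hanomV hlat K hK hHV hH3 hVK ι v vbar hv hvbar hne κ hκ γ
    (θsub.restrictField K) (θquot.restrictField K) hpairV Sf hSf (θquot.restrictField K) (Or.inr rfl) hRHq).1
  have hθs : ∀ σ : absoluteGaloisGroup K, θsub.restrictField K σ ^ (3 - 1) = 1 := fun σ ↦ by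
    rw [FramedGaloisRep.restrictField_apply]; exact hsub.1 _
  have hθq : ∀ σ : absoluteGaloisGroup K, θquot.restrictField K σ ^ (3 - 1) = 1 := fun σ ↦ by
    rw [FramedGaloisRep.restrictField_apply]; exact hquot.1 _
  have hdec : ¬ (decomp vbar ≤ κ.kerSubgroup) :=
    ZpExtension.decomp_not_le_kerSubgroup_above_of_isAnticyclotomic_holds K 3 hK hp2 κ hκ vbar hvbar
  -- the dévissage on `W₁`, in either orientation of the pair
  rcases hab with ⟨rfl, rfl⟩ | ⟨rfl, rfl⟩
  · obtain ⟨Da⟩ := nonempty_unrDualData_char (∅ : Set (PadicAlgCl 3)) (θsub.restrictField K) κ vbar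
      (↑Sf : Set (HeightOneSpectrum (𝓞 K))) hγ.out
    obtain ⟨Db⟩ := nonempty_unrDualData_char (∅ : Set (PadicAlgCl 3)) (θquot.restrictField K) κ vbar
      (↑Sf : Set (HeightOneSpectrum (𝓞 K))) hγ.out
    have hfin := KellerYinLemma511OfCharRH.finite_selmerAc_pTorsion_of_residualPair_of_dualData W₁ κ γ hvbar hdec hgood hθs hθq
      hpair Da Db (hSs Da) (hSq Db)
    exact ⟨KellerYinLemma511OfCharRH.isTorsion_muInvariant_eq_zero_of_residualPair_of_dualData W₁ κ γ hvbar hdec (Sf.finite_toSet)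
        hgood hθs hθq hpair Da Db (hSs Da) (hSq Db),
      KellerYinLemma511ResidualFinite.isTorsion_muInvariant_eq_zero_empty_of_residualFinite W₁ κ vbar γ _ hfin⟩
  · obtain ⟨Da⟩ := nonempty_unrDualData_char (∅ : Set (PadicAlgCl 3)) (θquot.restrictField K) κ vbar
      (↑Sf : Set (HeightOneSpectrum (𝓞 K))) hγ.out
    obtain ⟨Db⟩ := nonempty_unrDualData_char (∅ : Set (PadicAlgCl 3)) (θsub.restrictField K) κ vbar
      (↑Sf : Set (HeightOneSpectrum (𝓞 K))) hγ.out
    have hfin := KellerYinLemma511OfCharRH.finite_selmerAc_pTorsion_of_residualPair_of_dualData W₁ κ γ hvbar hdec hgood hθq hθs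
      hpair Da Db (hSq Da) (hSs Db)
    exact ⟨KellerYinLemma511OfCharRH.isTorsion_muInvariant_eq_zero_of_residualPair_of_dualData W₁ κ γ hvbar hdec (Sf.finite_toSet)
        hgood hθq hθs hpair Da Db (hSq Da) (hSs Db),
      KellerYinLemma511ResidualFinite.isTorsion_muInvariant_eq_zero_empty_of_residualFinite W₁ κ vbar γ _ hfin⟩

end SharedPair

/-! ### §2 [INV.μ] + torsion for the anomalous twist on instance clauses at its own pair (twin of generation 32's `…_of_RH_of_PWL_of_anomalousTwist`) -/

section Twist

variable {V W : WeierstrassCurve ℚ} [V.IsElliptic] [V.IsGloballyMinimal] [W.IsElliptic]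

/-- **[INV.μ] + THE TORSION CLAUSE FOR THE ANOMALOUS TWIST AT THE DOOR'S `Sf` — [RH] AS INSTANCE CLAUSES AT THE TWIST'S OWN PAIR, [PWL-θ] A TREE THEOREM.**
Generation 32's `AnomalousTwistPartnerFacts.xAc_moduleFinite_isTorsion_muInvariant_of_RH_of_PWL_of_anomalousTwist` re-keyed: the rational `3`-line `Ψ ≤ W[3]` and
its Teichmüller pair `(θsub, θquot)` over `ℚ` are now BINDERS (the original chose one by `exists_teichmullerPair`), the [RH] binder is REPLACED by the two instance
clauses `hRHs`, `hRHq` for `θsub|_K`, `θquot|_K` (they serve the Ribet member `V₁ ~ V` of the partner's class, whose rational line carries the SAME pair in one of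
the two orders — §2 of the source file), and [PWL-θ] is the tree theorem of F46.  `W = C • V^(−3)` with `V/ℚ` globally minimal, good ordinary and anomalous at `3`,
`W[3]` reducible; `K` imaginary quadratic, Heegner for `N_W`, `(3)` split; `ι`, `v`, `v̄`, `κ`, `γ`; `Sf` the `3`-FREE places of `K` over `N_W`: then
`X_ac^{Sf}(W_K[3^∞])` is finitely generated `Λ`-torsion with `μ = 0`, and `X_ac^∅(W_K[3^∞])` is `Λ`-torsion with `μ = 0`.  No named hypothesis.
[cite: KellerYin2024, Prop. 1.2.5, Prop. 1.3.1, Thm. 1.4.1, Lemma 5.1.1 (arXiv:2402.12781v2)] [cite: PollackWeston2011, App. A Prop. A.2]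
[cite: CastellaGrossiLeeSkinner2022, §1.4 Props. 17–18] [cite: Brink2007, Cor. 1] [cite: SilvermanAEC2009, X.5 Cor. 5.4, Cor. III.4.11, Cor. VII.7.2] -/
theorem xAc_moduleFinite_isTorsion_muInvariant_of_clauses_of_anomalousTwist
    (C : VariableChange ℚ) (hC : C • V.quadraticTwist (-3 : ℚ) = W) (hV : GoodOrd V 3) (ha : (3 : ℤ) ∣ V.frobeniusTrace 3 - 1)
    (hredW : Red W 3)
    (K : Type) [Field K] [NumberField K] (hK : IsImaginaryQuadratic K) (hH : SatisfiesHeegnerHypothesis (W.conductorNorm ℤ) K)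
    (hsplit : ((Ideal.span {(3 : ℤ)}).primesOver (𝓞 K)).ncard = 2)
    (ι : K →+* ℚ_[3]) (v vbar : HeightOneSpectrum (𝓞 K)) (hv : ∀ x : 𝓞 K, x ∈ v.asIdeal ↔ ‖ι (x : K)‖ < 1)
    (hvbar : ((3 : ℕ) : 𝓞 K) ∈ vbar.asIdeal) (hne : vbar ≠ v)
    (κ : ZpExtension K 3) (hκ : κ.IsAnticyclotomic) (γ : absoluteGaloisGroup K) [Fact (κ.IsTopGenerator γ)]
    {Ψ : AddSubgroup (geomTorsion W ((3 : ℕ) : ℤ))} (hΨ : IsRationalLine W 3 Ψ)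
    {θsub θquot : FramedGaloisRep ℚ (padicCoeffIntegers (∅ : Set (PadicAlgCl 3))) 1}
    (hsub : IsTeichmullerLiftOn (∅ : Set (PadicAlgCl 3)) (Ψ.map (geomTorsion W ((3 : ℕ) : ℤ)).subtype) θsub)
    (hquot : IsTeichmullerLiftOnQuot (∅ : Set (PadicAlgCl 3)) (Ψ.map (geomTorsion W ((3 : ℕ) : ℤ)).subtype)
      (geomTorsion W ((3 : ℕ) : ℤ)) θquot)
    (hRHs : ∀ D : DatumDualData κ γ (charModule ∅ (θsub.restrictField K))
        (Castella2018.AcSelmer.bdpData (charModule ∅ (θsub.restrictField K)) 3 vbar) (∅ : Set (HeightOneSpectrum (𝓞 K))),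
      Module.Finite (IwasawaAlgebra 3) D.X ∧ Module.IsTorsion (IwasawaAlgebra 3) D.X ∧ muInvariant 3 D.X = 0)
    (hRHq : ∀ D : DatumDualData κ γ (charModule ∅ (θquot.restrictField K))
        (Castella2018.AcSelmer.bdpData (charModule ∅ (θquot.restrictField K)) 3 vbar) (∅ : Set (HeightOneSpectrum (𝓞 K))),
      Module.Finite (IwasawaAlgebra 3) D.X ∧ Module.IsTorsion (IwasawaAlgebra 3) D.X ∧ muInvariant 3 D.X = 0)
    (Sf : Finset (HeightOneSpectrum (𝓞 K)))
    (hSf : ∀ w : HeightOneSpectrum (𝓞 K), w ∈ Sf ↔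
      (((W.conductorNorm ℤ : ℤ) : 𝓞 K) ∈ w.asIdeal ∧ ((3 : ℕ) : 𝓞 K) ∉ w.asIdeal)) :
    (Module.Finite (IwasawaAlgebra 3)
        (Castella2018.AcSelmer.XAc (W.baseChange K) 3 κ vbar (↑Sf : Set (HeightOneSpectrum (𝓞 K))) γ) ∧
      Module.IsTorsion (IwasawaAlgebra 3)
        (Castella2018.AcSelmer.XAc (W.baseChange K) 3 κ vbar (↑Sf : Set (HeightOneSpectrum (𝓞 K))) γ) ∧
      muInvariant 3 (Castella2018.AcSelmer.XAc (W.baseChange K) 3 κ vbar (↑Sf : Set (HeightOneSpectrum (𝓞 K))) γ) = 0) ∧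
    (Module.IsTorsion (IwasawaAlgebra 3) (Castella2018.AcSelmer.XAc (W.baseChange K) 3 κ vbar ∅ γ) ∧
      muInvariant 3 (Castella2018.AcSelmer.XAc (W.baseChange K) 3 κ vbar ∅ γ) = 0) := by
  haveI hEK : (W.baseChange K).IsElliptic := inferInstanceAs (W.map (algebraMap ℚ K)).IsElliptic
  have hp2 : (3 : ℕ) ≠ 2 := by norm_num
  -- the Ribet member of the partner's class and its standing data
  obtain ⟨V₁, _, _, hiso, hord₁, -, -, hanom₁, hlat₁⟩ := exists_ribetLattice_of_anomalousTwist C hC hV ha hredW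
  have hV₁K : ∀ Q : (V₁.baseChange K).toAffine.Point, 3 • Q = 0 → Q = 0 :=
    GoodLatticeNoKTorsion.forall_baseChange_nsmul_eq_zero_of_forall_not_lineUnramifiedAt hp2 hlat₁ hK.1 (by exact_mod_cast hsplit)
  have hH₁ : SatisfiesHeegnerHypothesis (V₁.conductorNorm ℤ) K := satisfiesHeegnerHypothesis_partnerClass C hC hV.1 hiso hH
  -- the place transfer and good reduction off `Sf ∪ {w ∣ 3}`
  have hSf₁ := mem_threeFree_iff_conductorNorm_partnerClass_mem C hC hV.1 hiso hSf
  have hgoodK : ∀ w : HeightOneSpectrum (𝓞 K), w ∉ (↑Sf : Set (HeightOneSpectrum (𝓞 K))) → ((3 : ℕ) : 𝓞 K) ∉ w.asIdeal →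
      (W.baseChange K).HasGoodReductionAt w :=
    fun w hw h3 ↦ hasGoodReductionAt_baseChange_of_not_mem_threeFree C hC hV.1 hiso K hSf w hw h3
  -- `W`'s pair over `ℚ`, its restriction, and the pair on `V₁` in one of the two orders
  have hpairW : IsResidualPairOver (W.baseChange K) 3 (θsub.restrictField K) (θquot.restrictField K) :=
    isResidualPairOver_restrictField W 3 K hΨ hsub hquot
  obtain ⟨L, hL, hor⟩ := exists_isRationalLine_partnerClass_of_twist C hC hiso hΨ hsub hquot
  rcases hor with ⟨h1, h2⟩ | ⟨h1, h2⟩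
  · exact xAc_moduleFinite_isTorsion_muInvariant_of_clauses_of_sharedPair hord₁ hanom₁ hlat₁ hL h1 h2 K hK hH₁ hsplit hV₁K
      ι v vbar hv hvbar hne κ hκ γ hRHq hRHs Sf hSf₁ (W.baseChange K) (Or.inr ⟨rfl, rfl⟩) hpairW hgoodK
  · exact xAc_moduleFinite_isTorsion_muInvariant_of_clauses_of_sharedPair hord₁ hanom₁ hlat₁ hL h1 h2 K hK hH₁ hsplit hV₁K
      ι v vbar hv hvbar hne κ hκ γ hRHs hRHq Sf hSf₁ (W.baseChange K) (Or.inl ⟨rfl, rfl⟩) hpairW hgoodK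

end Twist

end Summit.BirchSwinnertonDyer.BirchSwinnertonDyer.Theorems.SchneiderFreeAdditiveX3.AnomalousTwistMuZeroOfTree

end
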